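import Mathlib.Topology.Order.Basic
import Mathlib.Topology.MetricSpace.Pseudo.Defs
import Mathlib.Topology.Instances.Real.Lemmas
import Mathlib.Order.ConditionallyCompleteLattice.Basic
import HarnessLib

/-!
# The maximal time of a bootstrap ("continuity") argument, predicate form

Folklore tool: given a property `P` of times and an interval `[a, b]` with `P a`, the largest
`T* ∈ [a, b]` such that `P` holds on `[a, T*]` — `maximalTimeP P a b := sup {T ∈ [a, b] :
∀ t ∈ [a, T], P t}` — satisfies: `P` holds on `[a, T*)`; on `[a, T*]` if `P` is closed under
limits from the left; and the **exit principle**: either `T* = b`, or `P` fails at times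
arbitrarily close to `T*` inside `[a, b]` (i.e. `P` does not hold eventually at `T*` within
`[a, b]`). In particular, if `P` holds near `a` then `T* > a`. This is the form in which
"by a continuity argument" is used in ODE bootstrap proofs (e.g. the times `T₁, T₂, t_c` of §6.5–6.7
of T. Tao, J. Amer. Math. Soc. 29 (2016)); the real-valued special case `P t := f t ≤ 0` is
`Literature.Analysis.ODE.maximalTime` (`LinearComparison.lean`).

## References

* folklore (continuity method); cf. T. Tao, *Nonlinear dispersive equations*, CBMS 106 (2006),
  §1.3 "the continuity method".
-/

noncomputable section

open Set Filter Topology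

namespace Literature.Analysis.ODE

/-- The set of times `T ∈ [a, b]` up to which the property `P` persists. [folklore] -/
def goodTimesP (P : ℝ → Prop) (a b : ℝ) : Set ℝ := {T | T ∈ Icc a b ∧ ∀ t ∈ Icc a T, P t}

/-- The **maximal time** `T* = sup {T ∈ [a, b] : P on [a, T]}`. [folklore] -/
def maximalTimeP (P : ℝ → Prop) (a b : ℝ) : ℝ := sSup (goodTimesP P a b)

section

variable {P : ℝ → Prop} {a b : ℝ}

/-- `a` is a good time when `P a`. [folklore] -/
theorem mem_goodTimesP_left (hab : a ≤ b) (ha : P a) : a ∈ goodTimesP P a b :=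
  ⟨⟨le_rfl, hab⟩, fun t ht => by obtain rfl : t = a := le_antisymm ht.2 ht.1; exact ha⟩

/-- The good times are bounded above by `b`. [folklore] -/
theorem bddAbove_goodTimesP : BddAbove (goodTimesP P a b) := ⟨b, fun _ hT => hT.1.2⟩

/-- The maximal time lies in `[a, b]`. [folklore] -/
theorem maximalTimeP_mem (hab : a ≤ b) (ha : P a) : maximalTimeP P a b ∈ Icc a b :=
  ⟨le_csSup bddAbove_goodTimesP (mem_goodTimesP_left hab ha),
    csSup_le ⟨a, mem_goodTimesP_left hab ha⟩ fun _ hT => hT.1.2⟩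

/-- A good time is at most the maximal time. [folklore] -/
theorem le_maximalTimeP {T : ℝ} (hT : T ∈ Icc a b) (hgood : ∀ t ∈ Icc a T, P t) :
    T ≤ maximalTimeP P a b :=
  le_csSup bddAbove_goodTimesP ⟨hT, hgood⟩

/-- `P` holds at every time of `[a, T*)`. [folklore] -/
theorem maximalTimeP_spec_of_lt (hab : a ≤ b) (ha : P a) {t : ℝ} (hat : a ≤ t)
    (ht : t < maximalTimeP P a b) : P t := by
  obtain ⟨T, hTS, htT⟩ := exists_lt_of_lt_csSup ⟨a, mem_goodTimesP_left hab ha⟩ ht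
  exact hTS.2 t ⟨hat, htT.le⟩

/-- If `P` is closed under limits from the left inside `(a, b]`, then `P` holds on all of
`[a, T*]`. [folklore] -/
theorem maximalTimeP_spec (hab : a ≤ b) (ha : P a)
    (hclosed : ∀ t ∈ Ioc a b, (∀ s ∈ Ico a t, P s) → P t) {t : ℝ}
    (ht : t ∈ Icc a (maximalTimeP P a b)) : P t := by
  rcases lt_or_eq_of_le ht.2 with h | h
  · exact maximalTimeP_spec_of_lt hab ha ht.1 h
  · rcases eq_or_lt_of_le ht.1 with h' | h'
    · rw [← h']; exact ha
    · refine hclosed t ⟨h', h ▸ (maximalTimeP_mem hab ha).2⟩ fun s hs => ?_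
      exact maximalTimeP_spec_of_lt hab ha hs.1 (h ▸ hs.2)

/-- **Exit principle.** Either the maximal time is the final time `b`, or `P` does not hold
eventually at `T*` within `[a, b]` (i.e. `P` fails at times of `[a, b]` arbitrarily close to
`T*`). [folklore] -/
theorem maximalTimeP_exit (hab : a ≤ b) (ha : P a) :
    maximalTimeP P a b = b ∨ ¬ ∀ᶠ t in 𝓝[Icc a b] (maximalTimeP P a b), P t := by
  by_contra hcon
  push Not at hcon
  obtain ⟨hTb, hev⟩ := hcon
  have hT := maximalTimeP_mem hab ha
  have hTb' : maximalTimeP P a b < b := lt_of_le_of_ne hT.2 hTb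
  rw [eventually_nhdsWithin_iff, Metric.eventually_nhds_iff] at hev
  obtain ⟨δ, hδ, hδP⟩ := hev
  set T' := min b (maximalTimeP P a b + δ / 2) with hT'
  have hT'gt : maximalTimeP P a b < T' := lt_min hTb' (by linarith)
  have hT'good : T' ∈ goodTimesP P a b := by
    refine ⟨⟨hT.1.trans hT'gt.le, min_le_left _ _⟩, fun t ht => ?_⟩
    rcases lt_or_ge t (maximalTimeP P a b) with h | h
    · exact maximalTimeP_spec_of_lt hab ha ht.1 h
    · have htb : t ∈ Icc a b := ⟨ht.1, ht.2.trans (min_le_left _ _)⟩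
      have hdist : dist t (maximalTimeP P a b) < δ := by
        rw [Real.dist_eq, abs_of_nonneg (by linarith)]
        have : t ≤ maximalTimeP P a b + δ / 2 := ht.2.trans (min_le_right _ _)
        linarith
      exact hδP hdist htb
  have hle : T' ≤ maximalTimeP P a b := le_csSup bddAbove_goodTimesP hT'good
  linarith

/-- If `P` holds eventually at `a` within `[a, b]` (and `a < b`), the maximal time is `> a`.
[folklore] -/
theorem lt_maximalTimeP (hab : a < b) (ha : P a) (hev : ∀ᶠ t in 𝓝[Icc a b] a, P t) :
    a < maximalTimeP P a b := by
  have hT := maximalTimeP_mem hab.le ha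
  rcases eq_or_lt_of_le hT.1 with h | h
  · rcases maximalTimeP_exit hab.le ha with h' | h'
    · rw [h']; exact hab
    · rw [← h] at h'; exact absurd hev h'
  · exact h

/-- The exit principle when the clock has not run out: if `T* < b` then `P` is not eventually
true at `T*` within `[a, b]`. [folklore] -/
theorem not_eventually_of_maximalTimeP_lt (hab : a ≤ b) (ha : P a)
    (hlt : maximalTimeP P a b < b) : ¬ ∀ᶠ t in 𝓝[Icc a b] (maximalTimeP P a b), P t := by
  rcases maximalTimeP_exit hab ha with h | h
  · exact absurd h hlt.ne
  · exact h

end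

end Literature.Analysis.ODE
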